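import Summits.BirchSwinnertonDyer.BirchSwinnertonDyer.Theorems.RamifiedSevenEllipticUnitsRubinFormulaZpIffValue
import Summits.BirchSwinnertonDyer.BirchSwinnertonDyer.Theorems.RamifiedSevenEllipticUnitsValueIffBsdpAnyPrime
import Summits.BirchSwinnertonDyer.Rank1Residual.X12.O11.RouteUSevenFullBSD
import HarnessLib

set_option linter.dupNamespace false

/-!
# Route `RamifiedSevenEllipticUnits` (K7r), Value crux `EllipticUnitValueSevenOfGZK`
# (stmt-BirchSwinnertonDyer-19945), line `rubin-formula-zp`: the open stub `S_open`
# (`X12.O11.RamifiedCMRubinFormulaAtZp W p`) versus `BSD(W, p)` — `BSD(W, p)` certified at a member GIVES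
# `S_open` there (no IMC piece, no elliptic-unit input), `S_open ↔ BSD(W, p)` modulo (R-IMC)∃-Zp and four
# named facts, and `S_open` is a THEOREM on Route U's unit stratum of 𝒞₇ (cell `bsd-cm`, seat `bsd-cm-k7r-c3`
# g7, planner D121 «S_open kernel reduction»; THEOREMS ONLY — nothing asserted, no item closed, BSD not claimed)

HONEST FRAMING. Companion of k7r-c4's `RamifiedSevenEllipticUnitsRubinFormulaZpIffValue.lean` (the UNCONDITIONAL
`S_open ↔ (R-PR)|IMC-Zp`, `ramifiedCMRubinFormulaAtZp_iff_indexLawAtZp_holds`, landed minutes before this seat's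
identical reduction) and the `…Zp` twin of the BSD half of ram g8's `RamifiedSevenEllipticUnitsRubinFormulaIffValue.lean`
(p465172, written for the ℤ-span line that D117 found vacuous). With S_dict′, S_sat-Zp, S_B4′ THEOREMS, every
dictionary hypothesis of the old statements disappears:

* §1 `ramifiedCMBottomClassIndexLawAtZp_of_bsdp` / **`ramifiedCMRubinFormulaAtZp_of_bsdp`** — `BSD(W, p)` at
  analytic rank `≤ 1` ⟹ the corrected value law ⟹ `S_open`, granted Cassels, modularity, GZK only (k7r-c4's
  `ramifiedCMEllipticUnitIndexAt_of_bsdp` through the converse seam `ramifiedCMBottomClassIndexLawAtZp_of_indexAt`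
  and (R-tors) from GZK). NO IMC piece and NO elliptic-unit input in this direction: wherever `BSD(W, p)` is
  certified, the analytic ramified Rubin formula `λ₀ = 2(n + n') + ord_p q + ord_p q'` holds for every pinned
  datum satisfying the IMC identity.
* §1 `bsdp_of_ramifiedCMRubinFormulaAtZp_of_imcZp`, **`ramifiedCMRubinFormulaAtZp_iff_bsdp_of_imcZp`** — `S_open ↔
  BSD(W, p)` for a globally minimal CM curve of analytic rank one at its CM-ramified prime `p ≥ 5`, modulo
  (R-IMC)∃-Zp (the route's residual `EllipticUnitIMCSevenZp` at `p = 7`) and {modularity, GZ I.(7.3), GZK,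
  Cassels} — and NOTHING else. So the research content of the δ′-line's open stub is EXACTLY the `p`-part of
  BSD for `W`, read as «the `π`-adic index of the bottom elliptic-unit class in `E(K) ⊗ ℤ_p` equals
  `m_loc + ord_p(#Ш_an(W) #Ш_an(W'))`» — the place where a ramified-prime BDP-type formula / `p`-adic
  Gross–Zagier formula would act ([BKNO] §1.4: «the ramified counterparts … on which we will report
  elsewhere»; none in print — presearch 2026-08-27: corpus + galaxy, no hit).
* §2 Route level (𝒞₇, `p = 7`): `rubinFormulaSevenZp_of_bsdp` (per member) and
  **`rubinFormulaSevenZp_of_routeU`** — on Route U's UNIT STRATUM of 𝒞₇ (`RouteU.SelmerSevenBound W`: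
  `#Sel⁷(E/ℚ) ∣ 7`, and `RouteU.ShaAnSevenUnit W`: `ord₇ #Ш_an = 0` — both certified per member, e.g. the
  54 members `49a1^{(D)}`, `|D| ≤ 1500`, of generator level `0`, ROUTE-U memo §2) the OPEN stub `S_open` is a
  THEOREM, granted GZK, Cassels, modularity: a witness that the registered research stub cannot fail on the
  certified stratum.

PARTITION: CornerF-ramified@7 (B13/O11) × 𝒞₇ × 7 — types-the-object-of (and shrinks nothing: BSD₇ on the
unit stratum was already Route U's). Supports, does not close, stmt-BirchSwinnertonDyer-19945.
References: [BurungaleKobayashiNakamuraOta2026] arXiv:2608.06879 §1.4, Thm. 3.14 (3), Thm. 7.2 (shape only);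
[Miller2011LMS] Def. 1.1; [Cassels1965ArithmeticVIII]; [GrossZagier1986] Thm. I.(7.3); [KrizLi2019] Thm. 7.1;
cell STATUS D117, D121, D122.
-/

noncomputable section

open scoped Classical

open WeierstrassCurve NumberField IsDedekindDomain Field
  Literature.NumberTheory.EllipticCurves
  Literature.NumberTheory.EllipticCurves.Rank1Residual
  Literature.NumberTheory.EllipticCurves.BurungaleKobayashiNakamuraOta2026
  Literature.NumberTheory.GaloisRepresentations
  Summit.BirchSwinnertonDyer.Rank1Residual.Additive

namespace Summit.BirchSwinnertonDyer.BirchSwinnertonDyer.Theorems.RamifiedSevenEllipticUnits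

open Summit.BirchSwinnertonDyer.Rank1Residual Summit.BirchSwinnertonDyer.Rank1Residual.X12
  Summit.BirchSwinnertonDyer.Rank1Residual.X12.O11

namespace RubinFormulaZpBsdp

/-! ### §1. `S_open` versus `BSD(W, p)` at every CM-ramified prime -/

section AnyPrime

variable {W : WeierstrassCurve ℚ} [W.IsElliptic] [W.IsGloballyMinimal] {p : ℕ} [Fact p.Prime]

/-- **`BSD(W, p)` ⟹ (R-PR)|IMC-Zp at `W`**, granted Cassels, modularity and GZK (analytic rank `≤ 1`): the
converse seam `ramifiedCMBottomClassIndexLawAtZp_of_indexAt` fed with (R-EU) from `BSD(W, p)` (k7r-c4's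
`ramifiedCMEllipticUnitIndexAt_of_bsdp`) and (R-tors) from GZK (`ramifiedCMStrictTorsionAt_of_GZK`); NO
IMC piece is needed in this direction. The `…Zp` twin of `ramifiedCMBottomClassIndexLawAt_of_bsdp`.
[cite: Miller2011LMS, Def. 1.1 (arXiv:1010.2431 p. 3)] [cite: Cassels1965ArithmeticVIII] -/
theorem ramifiedCMBottomClassIndexLawAtZp_of_bsdp (hCassels : bsdRHS_eq_of_isIsogenous)
    (hmod : hasEntireLFunction_rat) (hGZK : rank_eq_analyticRank_of_analyticRank_le_one)
    (hr : W.analyticRank ≤ 1) (hB : BSDp W p) : RamifiedCMBottomClassIndexLawAtZp W p :=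
  ramifiedCMBottomClassIndexLawAtZp_of_indexAt
    (ramifiedCMEllipticUnitIndexAt_of_bsdp hCassels hmod hGZK hr hB) (ramifiedCMStrictTorsionAt_of_GZK hGZK W p)

/-- **`BSD(W, p)` ⟹ `S_open`** at analytic rank `≤ 1`, granted Cassels, modularity, GZK — NO dictionary
hypothesis (S_dict′, S_sat-Zp, S_B4′ are theorems: k7r-c4's `ramifiedCMRubinFormulaAtZp_iff_indexLawAtZp_holds`),
no IMC piece, no elliptic-unit input. [cite: Miller2011LMS, Def. 1.1 (arXiv:1010.2431 p. 3)] [cite: Cassels1965ArithmeticVIII] -/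
theorem ramifiedCMRubinFormulaAtZp_of_bsdp (hCassels : bsdRHS_eq_of_isIsogenous)
    (hmod : hasEntireLFunction_rat) (hGZK : rank_eq_analyticRank_of_analyticRank_le_one)
    (hr : W.analyticRank ≤ 1) (hB : BSDp W p) : RamifiedCMRubinFormulaAtZp W p :=
  RubinFormulaZpIffValue.ramifiedCMRubinFormulaAtZp_iff_indexLawAtZp_holds.2
    (ramifiedCMBottomClassIndexLawAtZp_of_bsdp hCassels hmod hGZK hr hB)

/-- **(R-PR)|IMC-Zp ⟹ `BSD(W, p)` at analytic rank one, granted (R-IMC)∃-Zp** and the four named facts: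
the seam `ramifiedCMEllipticUnitIndexAt_of_imcZp_of_indexLawZp` then
`bsdp_of_ramifiedCMEllipticUnitIndexAt_of_analyticRank_eq_one`. [cite: Miller2011LMS, Def. 1.1 (arXiv:1010.2431 p. 3)] -/
theorem bsdp_of_ramifiedCMBottomClassIndexLawAtZp_of_imcZp (hmod : hasEntireLFunction_rat)
    (hGZ : GrossZagier1986_thm_I_7_3) (hGZK : rank_eq_analyticRank_of_analyticRank_le_one)
    (hCassels : bsdRHS_eq_of_isIsogenous) (h1 : RamifiedCMEllipticUnitIMCAtZp W p) (hCM : W.HasCM)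
    (hram : CMRamified W p) (h5 : 5 ≤ p) (hr : W.analyticRank = 1)
    (h2 : RamifiedCMBottomClassIndexLawAtZp W p) : BSDp W p :=
  bsdp_of_ramifiedCMEllipticUnitIndexAt_of_analyticRank_eq_one hmod hGZ hGZK hCassels hCM hram h5 hr
    (ramifiedCMEllipticUnitIndexAt_of_imcZp_of_indexLawZp h1 h2)

/-- **`S_open` ⟹ `BSD(W, p)` at analytic rank one, granted (R-IMC)∃-Zp** and the four named facts.
[cite: Miller2011LMS, Def. 1.1 (arXiv:1010.2431 p. 3)] -/
theorem bsdp_of_ramifiedCMRubinFormulaAtZp_of_imcZp (hmod : hasEntireLFunction_rat)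
    (hGZ : GrossZagier1986_thm_I_7_3) (hGZK : rank_eq_analyticRank_of_analyticRank_le_one)
    (hCassels : bsdRHS_eq_of_isIsogenous) (h1 : RamifiedCMEllipticUnitIMCAtZp W p) (hCM : W.HasCM)
    (hram : CMRamified W p) (h5 : 5 ≤ p) (hr : W.analyticRank = 1)
    (hopen : RamifiedCMRubinFormulaAtZp W p) : BSDp W p :=
  bsdp_of_ramifiedCMBottomClassIndexLawAtZp_of_imcZp hmod hGZ hGZK hCassels h1 hCM hram h5 hr
    (RubinFormulaZpIffValue.ramifiedCMRubinFormulaAtZp_iff_indexLawAtZp_holds.1 hopen)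

/-- **(R-PR)|IMC-Zp ⟺ `BSD(W, p)`** for a globally minimal CM curve of analytic rank one at its CM-ramified
prime `p ≥ 5`, modulo (R-IMC)∃-Zp and {modularity, GZ I.(7.3), GZK, Cassels}. The `…Zp` twin of
`ramifiedCMBottomClassIndexLawAt_iff_bsdp_of_imc`. [cite: Miller2011LMS, Def. 1.1 (arXiv:1010.2431 p. 3)]
[cite: BurungaleKobayashiNakamuraOta2026, Thm. 3.14 (3) and §1.4 (arXiv:2608.06879; shape only)] -/
theorem ramifiedCMBottomClassIndexLawAtZp_iff_bsdp_of_imcZp (hmod : hasEntireLFunction_rat)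
    (hGZ : GrossZagier1986_thm_I_7_3) (hGZK : rank_eq_analyticRank_of_analyticRank_le_one)
    (hCassels : bsdRHS_eq_of_isIsogenous) (h1 : RamifiedCMEllipticUnitIMCAtZp W p) (hCM : W.HasCM)
    (hram : CMRamified W p) (h5 : 5 ≤ p) (hr : W.analyticRank = 1) :
    RamifiedCMBottomClassIndexLawAtZp W p ↔ BSDp W p :=
  ⟨bsdp_of_ramifiedCMBottomClassIndexLawAtZp_of_imcZp hmod hGZ hGZK hCassels h1 hCM hram h5 hr,
    ramifiedCMBottomClassIndexLawAtZp_of_bsdp hCassels hmod hGZK hr.le⟩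

/-- **`S_open ↔ BSD(W, p)`** for a globally minimal CM curve of analytic rank one at its CM-ramified prime
`p ≥ 5`, modulo (R-IMC)∃-Zp and the four named facts {modularity, GZ I.(7.3), GZK, Cassels} — and NOTHING
else (the dictionary stubs are theorems). The research content of the open stub is EXACTLY the `p`-part of
BSD for `W`, in the reading «`π`-adic index of the bottom elliptic-unit class in `E(K) ⊗ ℤ_p` = `m_loc +
ord_p(#Ш_an(W) #Ш_an(W'))`». [cite: Miller2011LMS, Def. 1.1 (arXiv:1010.2431 p. 3)]
[cite: BurungaleKobayashiNakamuraOta2026, Thm. 3.14 (3), Thm. 7.2 and §1.4 (arXiv:2608.06879; shape only)] -/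
theorem ramifiedCMRubinFormulaAtZp_iff_bsdp_of_imcZp (hmod : hasEntireLFunction_rat)
    (hGZ : GrossZagier1986_thm_I_7_3) (hGZK : rank_eq_analyticRank_of_analyticRank_le_one)
    (hCassels : bsdRHS_eq_of_isIsogenous) (h1 : RamifiedCMEllipticUnitIMCAtZp W p) (hCM : W.HasCM)
    (hram : CMRamified W p) (h5 : 5 ≤ p) (hr : W.analyticRank = 1) :
    RamifiedCMRubinFormulaAtZp W p ↔ BSDp W p :=
  RubinFormulaZpIffValue.ramifiedCMRubinFormulaAtZp_iff_indexLawAtZp_holds.trans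
    (ramifiedCMBottomClassIndexLawAtZp_iff_bsdp_of_imcZp hmod hGZ hGZK hCassels h1 hCM hram h5 hr)

end AnyPrime

/-! ### §2. Route level: 𝒞₇ at `p = 7` — the open stub on the BSD₇-certified stratum -/

section ClassCSeven

variable {W : WeierstrassCurve ℚ} [W.IsElliptic] [W.IsGloballyMinimal]

/-- **`BSD(W, 7)` certified at a 𝒞₇ member ⟹ the open stub's conclusion at that member**, granted
Cassels, modularity, GZK (analytic rank one is part of `ClassCSeven`).
[cite: Miller2011LMS, Def. 1.1 (arXiv:1010.2431 p. 3)] [cite: Cassels1965ArithmeticVIII] -/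
theorem rubinFormulaSevenZp_of_bsdp (hCassels : bsdRHS_eq_of_isIsogenous)
    (hmod : hasEntireLFunction_rat) (hGZK : rank_eq_analyticRank_of_analyticRank_le_one)
    (hW : X12.ClassCSeven W) (hB : BSDp W 7) : RamifiedCMRubinFormulaAtZp W 7 :=
  ramifiedCMRubinFormulaAtZp_of_bsdp hCassels hmod hGZK (le_of_eq hW.2.2.1) hB

/-- **`S_open` IS A THEOREM ON ROUTE U's UNIT STRATUM of 𝒞₇**: for a 𝒞₇ member with Route U's two
per-member inputs at `7` — (U-D) `RouteU.SelmerSevenBound W` (`#Sel⁷(E/ℚ) ∣ 7`) and (U-A)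
`RouteU.ShaAnSevenUnit W` (`#Ш_an ∈ ℚ` with `ord₇ #Ш_an = 0`), certified per member (kit / paper,
ROUTE-U memo) — Route U gives `BSD(W, 7)` (`RouteU.bsdp_seven_of_classCSeven`), hence the analytic
ramified Rubin formula `X12.O11.RamifiedCMRubinFormulaAtZp W 7` (here `λ₀ = 2(n + n')`), granted GZK,
Cassels, modularity. A kernel witness that the registered research stub `stub_rubinFormulaSevenZp` cannot
fail on the certified stratum; it says nothing about the rest of 𝒞₇. [cite: Miller2011LMS, §1 and Def. 1.1]
[cite: KrizLi2019, Thm. 7.1 and Rem. 1.21] -/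
theorem rubinFormulaSevenZp_of_routeU (hCassels : bsdRHS_eq_of_isIsogenous)
    (hmod : hasEntireLFunction_rat) (hGZK : rank_eq_analyticRank_of_analyticRank_le_one)
    (hW : X12.ClassCSeven W) (hD : RouteU.SelmerSevenBound W) (hA : RouteU.ShaAnSevenUnit W) :
    RamifiedCMRubinFormulaAtZp W 7 :=
  rubinFormulaSevenZp_of_bsdp hCassels hmod hGZK hW (RouteU.bsdp_seven_of_classCSeven W hGZK hW hD hA)

/-- **… and the corrected VALUE LAW (the crux body) on the same stratum**: `BSD(W, 7)` from Route U gives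
`X12.O11.RamifiedCMBottomClassIndexLawAtZp W 7` — the body of `EllipticUnitValueSevenOfGZK` at that member.
[cite: Miller2011LMS, §1 and Def. 1.1] [cite: KrizLi2019, Thm. 7.1 and Rem. 1.21] -/
theorem indexLawSevenZp_of_routeU (hCassels : bsdRHS_eq_of_isIsogenous)
    (hmod : hasEntireLFunction_rat) (hGZK : rank_eq_analyticRank_of_analyticRank_le_one)
    (hW : X12.ClassCSeven W) (hD : RouteU.SelmerSevenBound W) (hA : RouteU.ShaAnSevenUnit W) :
    RamifiedCMBottomClassIndexLawAtZp W 7 :=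
  ramifiedCMBottomClassIndexLawAtZp_of_bsdp hCassels hmod hGZK (le_of_eq hW.2.2.1)
    (RouteU.bsdp_seven_of_classCSeven W hGZK hW hD hA)

end ClassCSeven

end RubinFormulaZpBsdp

end Summit.BirchSwinnertonDyer.BirchSwinnertonDyer.Theorems.RamifiedSevenEllipticUnits

end
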